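import Summits.HodgeConjecture.HodgeConjecture.Theses.RigidRelativesJacobianTorelli
import Summits.HodgeConjecture.HodgeConjecture.Theorems.Ring2AbelianAllAndreCorrespondenceCategory
import HarnessLib

/-!
# Crux `CMCorrespondenceTate` (stmt-HodgeConjecture-18580), line `birth` — stub 4 `stub_algebraicComp`:
# composites of algebraic correspondences (equal dimensions, one degree) are algebraic

Route `HodgeConjecture/RigidRelativesJacobianTorelli`, crux `CMCorrespondenceTate` (rank 4; Tate for `X × X`, CM face);
registered skeleton `Cruxes/CMCorrespondenceTate/Lines/birth.lean` (`CMCorrespondenceTate_of`: anchor → CM twist →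
algebraic left inverse → composition → the crux by name). This file closes the registered stub

* **`stub_algebraicComp`** (signature VERBATIM; Fulton Def. 16.1.1 / Prop. 16.1.1, Voisin II Prop. 9.17 with
  Props. 9.20–9.21): for smooth projective complex `X, Y, Z` of the same dimension `n` and `T : Hᵏ(X(ℂ); ℂ) → Hᵏ(Y(ℂ); ℂ)`,
  `S : Hᵏ(Y(ℂ); ℂ) → Hᵏ(Z(ℂ); ℂ)` induced by algebraic classes on `Y × X`, `Z × Y`, the composite `S ∘ T` is induced by an
  algebraic class on `Z × X`.

At registration (2026-08-17) the tree had no composition lemma for `IsAlgebraicCorrespondence` on the real carriers; it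
has one since: part XXII-e of the AbelianAll André axis (`Ring2AbelianAllAndreCorrespondenceCategory`,
`IsAlgebraicCorrespondence.comp`). The stub is that theorem specialised to equal dimensions and one degree; the degree
proviso `k ≤ k + 2n` is trivial (the "corner `k > 2n`" of the skeleton's docstring needs no separate treatment: the
tree lemma reads the codimension off the given witnesses).

Nothing here is a case of the Hodge or Tate conjectures; no definition, no named fact, no sorry.
References: [Fulton1998] §16.1 Def. 16.1.1–16.1.2, Prop. 16.1.1; [VoisinHodgeII2003] §9.2 Prop. 9.17, (9.9),
Props. 9.20–9.21; [Kleiman1968AlgebraicCycles] §1.3, §3; [Andre1996Motifs] §2.1 (p. 14).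
-/

noncomputable section

-- every declaration of this problem lives in `Summit.HodgeConjecture.HodgeConjecture.…` (summit = sub-problem)
set_option linter.dupNamespace false

open CategoryTheory AlgebraicGeometry
open Literature.AlgebraicGeometry.Motives Literature.AlgebraicGeometry.HodgeTheory
open Summit.HodgeConjecture.HodgeConjecture.Ring2.AbelianAll

namespace Summit.HodgeConjecture.HodgeConjecture.Theorems.CMCorrespondenceTate

/-- **Stub `stub_algebraicComp` of crux `CMCorrespondenceTate` (registered signature, verbatim): composites of algebraic
correspondences `Hᵏ(X) → Hᵏ(Y) → Hᵏ(Z)` between smooth projective complex varieties of one dimension `n` are algebraic**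
(`[δ ∘ γ]_* = [δ]_* ∘ [γ]_*`, `δ ∘ γ = pr_{ZX*}(pr_{ZY}^* δ ∪ pr_{YX}^* γ)`; the tree's `IsAlgebraicCorrespondence.comp`).
[cite: Fulton1998, §16.1 Def. 16.1.1 and Prop. 16.1.1] [cite: VoisinHodgeII2003, §9.2 Prop. 9.17 and Props. 9.20–9.21]
[cite: Kleiman1968AlgebraicCycles, §3] -/
theorem stub_algebraicComp :
    ∀ (n k : ℕ) (X Y Z : SchemeOver.{0} ℂ),
      IsSmoothProjective n X → IsSmoothProjective n Y → IsSmoothProjective n Z →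
        ∀ (T : complexBetti X k →ₗ[ℂ] complexBetti Y k) (S : complexBetti Y k →ₗ[ℂ] complexBetti Z k),
          IsAlgebraicCorrespondence n n Y X T → IsAlgebraicCorrespondence n n Z Y S →
            IsAlgebraicCorrespondence n n Z X (S ∘ₗ T) :=
  fun _ _ _ _ _ hX hY hZ _ _ hT hS ↦ IsAlgebraicCorrespondence.comp hZ hY hX hT hS (by omega)

end Summit.HodgeConjecture.HodgeConjecture.Theorems.CMCorrespondenceTate

end
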